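import Summits.NavierStokesRegularity.FunctionalMining.TopEigGapCutoffPowDensity
import HarnessLib

/-!
# FunctionalMining — L-λ(η) BELOW `q = 2`: the cut-off calculus of `H_δ(s) = G_δ(s)s^{q−2}` for `1 ≤ q ≤ 2`

HONEST FRAMING. Search for candidate a priori estimates; no regularity claim. Cell `pub-nsfunc`, prove
seat (gen 32). Nothing about Navier–Stokes is asserted: calculus about the tree's cut-off objects
(`cutPow δ q = H_δ`, `cutPowDeriv = H_δ'`, `cutProjPow = M^δ_q = H_δ(λ₁)P₁`, `cutDensityPow = ρ^δ_q` of
`TopEigCutoffPow` / `TopEigGapCutoffPowDeriv` / `TopEigGapCutoffPowDensity`), whose pointwise inequalities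
the tree proves under `2 ≤ q` only. NEW, for `1 ≤ q ≤ 2` (`δ > 0`, `s > 0`): (1) ONE VARIABLE —
`G_δ(s) ≤ s·g_δ(s)` (the step `g_δ` is non-decreasing), hence `H_δ' ≥ (q−1)g_δ s^{q−2} ≥ 0` for every real
`q ≥ 1` (`cutPowDeriv_nonneg_of_one_le`), `H_δ' ≤ s^{q−2}`, `H_δ'² ≤ s^{q−2}H_δ'` (`q ≤ 2`); the UNIFORM
weight error `0 ≤ s^{q−1} − H_δ(s) ≤ (2δ)^{q−1}` (`1 < q ≤ 2`; the tree's `≤ 2δs^{q−2}` is unbounded near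
`0` below `q = 2`); the TWO-LEVEL comparison `H_δ ≤ 2H_ε`, `(q−1)H_δ' ≤ H_ε'` for `0 < ε`, `4ε ≤ s`;
continuity of `H_δ`. (2) AT A POINT of a smooth divergence-free field of the top-gap class
`λ₂ ≤ (1−η)λ₁`, `0 < η ≤ 1`: `∑ₖᵢⱼ(∂ₖM^δ_qᵢⱼ)² ≤ (1/(2η))λ₁^{q−2}ρ^δ_q`, `0 ≤ ρ^δ_q` (`1 ≤ q ≤ 2`), and
**`ρ^δ_q(x) ≤ (2/(q−1))ρ^ε_q(x)`** at every point (`1 < q ≤ 2`, `4ε ≤ δ`). Inputs of the sequel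
(`TopEigGapCutoffLowHeat`, `TopEigGapCoerciveBelowTwo`: the node `TopEigGapCoercivePos q η` for every
real `6/5 ≤ q < 2` on the WHOLE top-gap class). NOT CLAIMED: anything about the node here; `q < 1`.

[ours; folklore one-variable calculus + the tree's eigenframe identities at a simple point]
FILING (prove seat g32, SLOT OWN-B1, LEAD (58g) INBOX l.5704): = staged `pub-nsfunc-prove/staged/g32-own/TopEigGapCutoffLow.lean` 1eb2dfa4bfe320d4; this line is the only addition.
-/

noncomputable section

open Filter Topology Matrix Finset MeasureTheory Set
open scoped ContDiff

namespace Summit.NavierStokesRegularity.FunctionalMining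

open Literature.Analysis Literature.Analysis.FunctionSpaces Literature.Analysis.FunctionSpaces.Torus
  SharpClass.DirectorForm Literature.Analysis.Matrix

namespace TopEig

/-! ## 1. One-variable calculus of `H_δ` for `1 ≤ q ≤ 2` -/

/-- The step `g_δ` is non-decreasing (`δ > 0`). [folklore] -/
theorem cutStep_mono {δ : ℝ} (hδ : 0 < δ) {r s : ℝ} (hrs : r ≤ s) : cutStep δ r ≤ cutStep δ s :=
  Real.smoothTransition.monotone (sub_le_sub_right (div_le_div_of_nonneg_right hrs hδ.le) 1)

/-- **`G_δ(s) ≤ s · g_δ(s)`** for `0 ≤ s` (`δ > 0`): the integrand `g_δ(r)`, `r ≤ s`, is `≤ g_δ(s)`. [folklore] -/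
theorem cutRamp_le_mul_cutStep {δ s : ℝ} (hδ : 0 < δ) (hs : 0 ≤ s) : cutRamp δ s ≤ s * cutStep δ s := by
  unfold cutRamp
  have h := intervalIntegral.integral_mono_on hs ((continuous_cutStep δ).intervalIntegrable 0 s)
    (intervalIntegrable_const (μ := volume) (c := cutStep δ s)) fun r hr => cutStep_mono hδ hr.2
  rw [intervalIntegral.integral_const, smul_eq_mul, sub_zero] at h
  exact h

/-- **`(q−1) g_δ(s) s^{q−2} ≤ H_δ'(s)`** for `s > 0`, `δ > 0`, `q ≤ 2` (`H_δ' = g s^{q−2} + (q−2)G s^{q−3}`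
and `(q−2)G ≥ (q−2)·s g` since `G ≤ s g`). [folklore] -/
theorem mul_cutStep_rpow_le_cutPowDeriv {δ q s : ℝ} (hq2 : q ≤ 2) (hδ : 0 < δ) (hs : 0 < s) :
    (q - 1) * cutStep δ s * s ^ (q - 2) ≤ cutPowDeriv δ q s := by
  unfold cutPowDeriv
  have hG := cutRamp_le_mul_cutStep hδ hs.le
  have h3 : 0 ≤ s ^ (q - 3) := Real.rpow_nonneg hs.le _
  have e : s * s ^ (q - 3) = s ^ (q - 2) := by
    rw [show q - 2 = 1 + (q - 3) by ring, Real.rpow_add hs, Real.rpow_one]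
  have h1 : (q - 2) * (s * cutStep δ s) * s ^ (q - 3) ≤ (q - 2) * cutRamp δ s * s ^ (q - 3) :=
    mul_le_mul_of_nonneg_right (mul_le_mul_of_nonpos_left hG (by linarith)) h3
  have e2 : (q - 2) * (s * cutStep δ s) * s ^ (q - 3) = (q - 2) * cutStep δ s * s ^ (q - 2) := by
    rw [← e]; ring
  rw [e2] at h1
  nlinarith

/-- **`0 ≤ H_δ'(s)`** for `s > 0`, `δ > 0` and EVERY real `q ≥ 1` (the tree's `cutPowDeriv_nonneg` asks
`2 ≤ q`). [folklore] -/
theorem cutPowDeriv_nonneg_of_one_le {δ q s : ℝ} (hq : 1 ≤ q) (hδ : 0 < δ) (hs : 0 < s) :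
    0 ≤ cutPowDeriv δ q s := by
  rcases le_or_gt q 2 with hq2 | hq2
  · have h := mul_cutStep_rpow_le_cutPowDeriv hq2 hδ hs
    have h0 : 0 ≤ (q - 1) * cutStep δ s * s ^ (q - 2) :=
      mul_nonneg (mul_nonneg (by linarith) (cutStep_nonneg δ s)) (Real.rpow_nonneg hs.le _)
    exact h0.trans h
  · exact cutPowDeriv_nonneg hq2.le hs

/-- **`H_δ'(s) ≤ s^{q−2}`** for `s > 0`, `q ≤ 2` (`g ≤ 1`, `(q−2)G ≤ 0`). [folklore] -/
theorem cutPowDeriv_le_rpow_of_le_two {δ q s : ℝ} (hq2 : q ≤ 2) (hs : 0 < s) :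
    cutPowDeriv δ q s ≤ s ^ (q - 2) := by
  unfold cutPowDeriv
  have h2 : 0 ≤ s ^ (q - 2) := Real.rpow_nonneg hs.le _
  have h3 : 0 ≤ s ^ (q - 3) := Real.rpow_nonneg hs.le _
  have hg := cutStep_le_one δ s
  have hG := cutRamp_nonneg (δ := δ) hs.le
  have ha : cutStep δ s * s ^ (q - 2) ≤ s ^ (q - 2) := by nlinarith
  have hb : (q - 2) * cutRamp δ s * s ^ (q - 3) ≤ 0 :=
    mul_nonpos_of_nonpos_of_nonneg (mul_nonpos_of_nonpos_of_nonneg (by linarith) hG) h3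
  linarith

/-- **`H_δ'(s)² ≤ s^{q−2} · H_δ'(s)`** for `s > 0`, `δ > 0`, `1 ≤ q ≤ 2`. [folklore] -/
theorem cutPowDeriv_sq_le_of_le_two {δ q s : ℝ} (hq1 : 1 ≤ q) (hq2 : q ≤ 2) (hδ : 0 < δ) (hs : 0 < s) :
    cutPowDeriv δ q s ^ 2 ≤ s ^ (q - 2) * cutPowDeriv δ q s := by
  have h0 := cutPowDeriv_nonneg_of_one_le (δ := δ) hq1 hδ hs
  have h1 := cutPowDeriv_le_rpow_of_le_two (δ := δ) hq2 hs
  nlinarith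

/-- For `s ≥ 0`, `q > 1`, `δ > 0`: `0 ≤ s^{q−1} − H_δ(s) ≤ 2δ s^{q−2}` (the tree's `rpow_sub_cutPow_mem`
asks `2 < q`; at `s = 0` both sides are harmless junk `≥ 0`). [folklore] -/
theorem rpow_sub_cutPow_mem_of_one_lt {δ q s : ℝ} (hδ : 0 < δ) (hq : 1 < q) (hs : 0 ≤ s) :
    0 ≤ s ^ (q - 1) - cutPow δ q s ∧ s ^ (q - 1) - cutPow δ q s ≤ 2 * δ * s ^ (q - 2) := by
  rcases hs.eq_or_lt with h0 | hpos
  · rw [← h0, cutPow_of_le hδ hδ.le, Real.zero_rpow (by linarith), sub_zero]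
    exact ⟨le_rfl, by positivity⟩
  · exact ⟨rpow_sub_cutPow_nonneg q hpos, rpow_sub_cutPow_le q hδ hpos⟩

/-- **THE UNIFORM WEIGHT ERROR BELOW `q = 2`: `s^{q−1} − H_δ(s) ≤ (2δ)^{q−1}`** for `s ≥ 0`, `δ > 0`,
`1 < q ≤ 2` (`= s^{q−2}(s − G_δ(s))`, `0 ≤ s − G_δ ≤ min(s, 2δ)`; split at `s = 2δ`). [folklore] -/
theorem rpow_sub_cutPow_le_of_le_two {δ q s : ℝ} (hq1 : 1 < q) (hq2 : q ≤ 2) (hδ : 0 < δ) (hs : 0 ≤ s) :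
    s ^ (q - 1) - cutPow δ q s ≤ (2 * δ) ^ (q - 1) := by
  have h2δ : 0 < 2 * δ := by linarith
  rcases hs.eq_or_lt with h0 | hpos
  · rw [← h0, cutPow_of_le hδ hδ.le, Real.zero_rpow (by linarith), sub_zero]
    exact Real.rpow_nonneg h2δ.le _
  have e : s ^ (q - 1) - cutPow δ q s = s ^ (q - 2) * (s - cutRamp δ s) := by
    rw [cutPow, show q - 1 = 1 + (q - 2) by ring, Real.rpow_add hpos, Real.rpow_one]; ring
  rw [e]
  have hL0 : 0 ≤ s ^ (q - 2) := Real.rpow_nonneg hs _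
  rcases le_or_gt s (2 * δ) with hle | hgt
  · -- `s ≤ 2δ`: `s^{q−2}(s − G) ≤ s^{q−2} s = s^{q−1} ≤ (2δ)^{q−1}`
    have h1 : s ^ (q - 2) * (s - cutRamp δ s) ≤ s ^ (q - 2) * s :=
      mul_le_mul_of_nonneg_left (by linarith [cutRamp_nonneg (δ := δ) hs]) hL0
    have e1 : s ^ (q - 2) * s = s ^ (q - 1) := by
      rw [show q - 1 = (q - 2) + 1 by ring, Real.rpow_add hpos, Real.rpow_one]
    rw [e1] at h1
    exact h1.trans (Real.rpow_le_rpow hs hle (by linarith))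
  · -- `2δ < s`: `s^{q−2}(s − G) ≤ s^{q−2} 2δ ≤ (2δ)^{q−2} 2δ = (2δ)^{q−1}`
    have h1 : s ^ (q - 2) * (s - cutRamp δ s) ≤ s ^ (q - 2) * (2 * δ) :=
      mul_le_mul_of_nonneg_left (self_sub_cutRamp_le hδ hs) hL0
    have h2 : s ^ (q - 2) * (2 * δ) ≤ (2 * δ) ^ (q - 2) * (2 * δ) :=
      mul_le_mul_of_nonneg_right (Real.rpow_le_rpow_of_nonpos h2δ hgt.le (by linarith)) h2δ.le
    have e2 : (2 * δ) ^ (q - 2) * (2 * δ) = (2 * δ) ^ (q - 1) := by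
      rw [show q - 1 = (q - 2) + 1 by ring, Real.rpow_add h2δ, Real.rpow_one]
    rw [e2] at h2
    exact h1.trans h2

/-- **TWO LEVELS, THE WEIGHT: `H_δ(s) ≤ 2 H_ε(s)`** for `0 < ε`, `4ε ≤ s`, any `δ`, any real `q`
(`H_δ ≤ s^{q−1}` and `H_ε(s) = G_ε(s)s^{q−2} ≥ (s − 2ε)s^{q−2} ≥ (s/2)s^{q−2}`). [folklore] -/
theorem cutPow_le_two_mul_cutPow {δ ε q s : ℝ} (hε : 0 < ε) (hs : 4 * ε ≤ s) :
    cutPow δ q s ≤ 2 * cutPow ε q s := by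
  have hpos : 0 < s := by linarith
  have hL0 : 0 ≤ s ^ (q - 2) := Real.rpow_nonneg hpos.le _
  have h1 : cutPow δ q s ≤ s ^ (q - 1) := cutPow_le q hpos
  have h2 : s - 2 * ε ≤ cutRamp ε s := self_sub_le_cutRamp hε hpos.le
  have e : s ^ (q - 1) = s * s ^ (q - 2) := by
    rw [show q - 1 = 1 + (q - 2) by ring, Real.rpow_add hpos, Real.rpow_one]
  have h3 : s * s ^ (q - 2) ≤ 2 * ((s - 2 * ε) * s ^ (q - 2)) := by nlinarith
  have h4 : (s - 2 * ε) * s ^ (q - 2) ≤ cutRamp ε s * s ^ (q - 2) := mul_le_mul_of_nonneg_right h2 hL0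
  have h5 : 2 * cutPow ε q s = 2 * (cutRamp ε s * s ^ (q - 2)) := by rw [cutPow]
  linarith

/-- Beyond the ramp: **`(q−1) s^{q−2} ≤ H_ε'(s)`** for `0 < ε`, `2ε ≤ s`, `q ≤ 2` (`g_ε(s) = 1`). [folklore] -/
theorem mul_rpow_le_cutPowDeriv_of_ge {ε q s : ℝ} (hq2 : q ≤ 2) (hε : 0 < ε) (hs : 2 * ε ≤ s) :
    (q - 1) * s ^ (q - 2) ≤ cutPowDeriv ε q s := by
  have hpos : 0 < s := by linarith
  have h := mul_cutStep_rpow_le_cutPowDeriv (δ := ε) hq2 hε hpos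
  rw [cutStep_of_ge hε hs, mul_one] at h
  exact h

/-- **TWO LEVELS, THE DERIVATIVE: `(q−1) H_δ'(s) ≤ H_ε'(s)`** for `0 < ε`, `2ε ≤ s`, any `δ`,
`q ≤ 2` (`H_δ' ≤ s^{q−2} ≤ H_ε'/(q−1)`). [folklore] -/
theorem mul_cutPowDeriv_le_cutPowDeriv {δ ε q s : ℝ} (hq1 : 1 ≤ q) (hq2 : q ≤ 2) (hε : 0 < ε)
    (hs : 2 * ε ≤ s) : (q - 1) * cutPowDeriv δ q s ≤ cutPowDeriv ε q s := by
  have hpos : 0 < s := by linarith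
  exact (mul_le_mul_of_nonneg_left (cutPowDeriv_le_rpow_of_le_two (δ := δ) hq2 hpos) (by linarith)).trans
    (mul_rpow_le_cutPowDeriv_of_ge hq2 hε hs)

/-- `H_δ` is continuous on `ℝ` (`δ > 0`, any real `q`): `≡ 0` on `(−∞, δ)`, a continuous product on `(0, ∞)`. [folklore] -/
theorem continuous_cutPow {δ : ℝ} (hδ : 0 < δ) (q : ℝ) : Continuous (cutPow δ q) := by
  refine continuous_iff_continuousAt.2 fun s => ?_
  rcases lt_or_ge s δ with hs | hs
  · have hev : (cutPow δ q) =ᶠ[𝓝 s] fun _ => (0 : ℝ) := by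
      filter_upwards [Iio_mem_nhds hs] with r hr
      exact cutPow_of_le hδ (le_of_lt hr)
    exact (continuousAt_const.congr (f := fun _ => (0 : ℝ)) hev.symm)
  · have hpos : 0 < s := lt_of_lt_of_le hδ hs
    exact ((continuous_cutRamp δ).continuousAt).mul (Real.continuousAt_rpow_const _ _ (Or.inl hpos.ne'))

/-! ## 2. The gradient of `M^δ_q` at a simple point, `1 ≤ q ≤ 2` -/

variable {v : UnitAddTorus (Fin 3) → EuclideanSpace ℝ (Fin 3)}

/-- **`∑ₖ∑ᵢⱼ (∂ₖ M^δ_qᵢⱼ(x))² ≤ λ₁^{q−2} · (H'(λ₁) A + (2/η) H(λ₁) R)` at a simple point of the top-gap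
class**, for `δ > 0`, `0 < η` and `1 ≤ q ≤ 2` (the tree's `sum_sq_partialDeriv_cutProjPow_le_of_gap` has the
factor `q − 1 ≥ 1` in front of `H'A` and asks `2 ≤ q`; below `2` one uses `H'² ≤ λ₁^{q−2}H'`). [ours] -/
theorem sum_sq_partialDeriv_cutProjPow_le_of_gap_of_le_two (hv : Torus.IsSmooth v) (hdiv : Torus.IsDivFree v)
    {δ q η : ℝ} (hq1 : 1 ≤ q) (hq2 : q ≤ 2) (hδ : 0 < δ) (hη0 : 0 < η)
    {x : UnitAddTorus (Fin 3)} (hx : torusStrainMidEig v x < torusStrainTopEig v x)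
    (hgapx : torusStrainMidEig v x ≤ (1 - η) * torusStrainTopEig v x) :
    ∑ k, ∑ i, ∑ j, (Torus.partialDeriv k (cutProjPow δ q v i j) x) ^ 2 ≤
      torusStrainTopEig v x ^ (q - 2) *
        (cutPowDeriv δ q (torusStrainTopEig v x) * topDiagSq v x +
          2 / η * cutPow δ q (torusStrainTopEig v x) * topChannelW v x) := by
  set lam : ℝ := torusStrainTopEig v x with hlam
  have hlam0 : 0 < lam := topEig_pos_of_simple hv hdiv hx
  set gx : ℝ := cutPowDeriv δ q lam with hgx
  set Gx : ℝ := cutPow δ q lam with hGx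
  set L : ℝ := lam ^ (q - 2) with hL
  have hL0 : 0 ≤ L := Real.rpow_nonneg hlam0.le _
  have hgx0 : 0 ≤ gx := cutPowDeriv_nonneg_of_one_le hq1 hδ hlam0
  have hGx0 : 0 ≤ Gx := cutPow_nonneg q hlam0.le
  have hg2 : gx ^ 2 ≤ L * gx := cutPowDeriv_sq_le_of_le_two hq1 hq2 hδ hlam0
  have hG2 : Gx ^ 2 ≤ lam * L * Gx := cutPow_sq_le' q hlam0
  have hk : ∀ k : Fin 3, ∑ i, ∑ j, (Torus.partialDeriv k (cutProjPow δ q v i j) x) ^ 2 ≤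
      L * (gx * (topVec v x ⬝ᵥ (torusStrainMatrix (Torus.partialDeriv k v) x *ᵥ topVec v x)) ^ 2) +
        L * (2 / η * Gx * ∑ b ∈ Finset.univ.erase (topIndex v x),
          (((torusStrainMatrix_isHermitian v x).eigenvectorBasis b).ofLp ⬝ᵥ
              (torusStrainMatrix (Torus.partialDeriv k v) x *ᵥ topVec v x)) ^ 2 /
            (lam - (torusStrainMatrix_isHermitian v x).eigenvalues b)) := by
    intro k
    rw [sum_sq_partialDeriv_cutProjPow_eq hv hdiv δ q hx k]
    set a : ℝ := topVec v x ⬝ᵥ (torusStrainMatrix (Torus.partialDeriv k v) x *ᵥ topVec v x) with hadef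
    have hW : ∑ b ∈ Finset.univ.erase (topIndex v x),
        ((((torusStrainMatrix_isHermitian v x).eigenvectorBasis b).ofLp ⬝ᵥ
            (torusStrainMatrix (Torus.partialDeriv k v) x *ᵥ topVec v x)) /
          (lam - (torusStrainMatrix_isHermitian v x).eigenvalues b)) ^ 2 ≤
        (η * lam)⁻¹ * ∑ b ∈ Finset.univ.erase (topIndex v x),
          (((torusStrainMatrix_isHermitian v x).eigenvectorBasis b).ofLp ⬝ᵥ
              (torusStrainMatrix (Torus.partialDeriv k v) x *ᵥ topVec v x)) ^ 2 /
            (lam - (torusStrainMatrix_isHermitian v x).eigenvalues b) := by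
      rw [Finset.mul_sum]
      refine Finset.sum_le_sum fun b hb => ?_
      have hne : b ≠ topIndex v x := (Finset.mem_erase.1 hb).1
      have hle := eigenvalues_le_midEig_of_ne hx (eigenvalues_topIndex v x) hne
      set cb : ℝ := ((torusStrainMatrix_isHermitian v x).eigenvectorBasis b).ofLp ⬝ᵥ
        (torusStrainMatrix (Torus.partialDeriv k v) x *ᵥ topVec v x)
      set gap : ℝ := lam - (torusStrainMatrix_isHermitian v x).eigenvalues b with hgapdef
      have hga : η * lam ≤ gap := by rw [hgapdef]; nlinarith
      have hηl : 0 < η * lam := mul_pos hη0 hlam0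
      have hgap0 : 0 < gap := lt_of_lt_of_le hηl hga
      rw [div_pow, sq gap, ← div_div, div_eq_mul_inv (cb ^ 2 / gap), mul_comm (cb ^ 2 / gap)]
      exact mul_le_mul_of_nonneg_right (inv_anti₀ hηl hga) (div_nonneg (sq_nonneg _) hgap0.le)
    set Rk : ℝ := ∑ b ∈ Finset.univ.erase (topIndex v x),
      (((torusStrainMatrix_isHermitian v x).eigenvectorBasis b).ofLp ⬝ᵥ
          (torusStrainMatrix (Torus.partialDeriv k v) x *ᵥ topVec v x)) ^ 2 /
        (lam - (torusStrainMatrix_isHermitian v x).eigenvalues b) with hRk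
    have hRk0 : 0 ≤ Rk := Finset.sum_nonneg fun b hb => by
      have hle := eigenvalues_le_midEig_of_ne hx (eigenvalues_topIndex v x) (Finset.ne_of_mem_erase hb)
      exact div_nonneg (sq_nonneg _) (by linarith)
    -- `(H' a)² ≤ L H' a²`
    have hdiag : (gx * a) ^ 2 ≤ L * (gx * a ^ 2) := by
      rw [mul_pow]
      have := mul_le_mul_of_nonneg_right hg2 (sq_nonneg a)
      calc gx ^ 2 * a ^ 2 ≤ L * gx * a ^ 2 := this
        _ = L * (gx * a ^ 2) := by ring
    -- `2 H² W ≤ L (2/η) H R`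
    have hchan : 2 * Gx ^ 2 * ∑ b ∈ Finset.univ.erase (topIndex v x),
        ((((torusStrainMatrix_isHermitian v x).eigenvectorBasis b).ofLp ⬝ᵥ
            (torusStrainMatrix (Torus.partialDeriv k v) x *ᵥ topVec v x)) /
          (lam - (torusStrainMatrix_isHermitian v x).eigenvalues b)) ^ 2 ≤ L * (2 / η * Gx * Rk) := by
      have h1 : 2 * Gx ^ 2 * ∑ b ∈ Finset.univ.erase (topIndex v x),
          ((((torusStrainMatrix_isHermitian v x).eigenvectorBasis b).ofLp ⬝ᵥ
              (torusStrainMatrix (Torus.partialDeriv k v) x *ᵥ topVec v x)) /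
            (lam - (torusStrainMatrix_isHermitian v x).eigenvalues b)) ^ 2 ≤
          2 * Gx ^ 2 * ((η * lam)⁻¹ * Rk) := mul_le_mul_of_nonneg_left hW (by positivity)
      have h2 : 2 * Gx ^ 2 * ((η * lam)⁻¹ * Rk) ≤ 2 * (lam * L * Gx) * ((η * lam)⁻¹ * Rk) :=
        mul_le_mul_of_nonneg_right (mul_le_mul_of_nonneg_left hG2 (by norm_num))
          (mul_nonneg (inv_nonneg.2 (mul_pos hη0 hlam0).le) hRk0)
      have e : 2 * (lam * L * Gx) * ((η * lam)⁻¹ * Rk) = L * (2 / η * Gx * Rk) := by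
        have hl : lam ≠ 0 := hlam0.ne'
        field_simp
      linarith
    exact add_le_add hdiag hchan
  have hsum : ∑ k : Fin 3, (L * (gx *
          (topVec v x ⬝ᵥ (torusStrainMatrix (Torus.partialDeriv k v) x *ᵥ topVec v x)) ^ 2) +
        L * (2 / η * Gx * ∑ b ∈ Finset.univ.erase (topIndex v x),
          (((torusStrainMatrix_isHermitian v x).eigenvectorBasis b).ofLp ⬝ᵥ
              (torusStrainMatrix (Torus.partialDeriv k v) x *ᵥ topVec v x)) ^ 2 /
            (lam - (torusStrainMatrix_isHermitian v x).eigenvalues b))) =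
      L * (gx * topDiagSq v x + 2 / η * Gx * topChannelW v x) := by
    unfold topDiagSq topChannelW
    rw [Finset.sum_add_distrib, ← Finset.mul_sum, ← Finset.mul_sum, ← Finset.mul_sum, ← Finset.mul_sum]
    ring
  exact (Finset.sum_le_sum fun k _ => hk k).trans hsum.le

/-! ## 3. The density `ρ^δ_q` for `1 ≤ q ≤ 2`: sign, domination of the gradient, two levels -/

/-- On the top-gap class (`1 ≤ q`, `0 < η`, `δ > 0`), **`0 ≤ cutDensityPow δ q v x` at every point** (the
tree's `cutDensityPow_nonneg` asks `2 ≤ q`). [ours] -/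
theorem cutDensityPow_nonneg_of_one_le (hv : Torus.IsSmooth v) (hdiv : Torus.IsDivFree v)
    {δ q η : ℝ} (hq : 1 ≤ q) (hδ : 0 < δ) (hη0 : 0 < η)
    (hgap : ∀ x : UnitAddTorus (Fin 3), torusStrainMidEig v x ≤ (1 - η) * torusStrainTopEig v x)
    (x : UnitAddTorus (Fin 3)) : 0 ≤ cutDensityPow δ q v x := by
  by_cases hlt : torusStrainTopEig v x < δ
  · rw [cutDensityPow_eq_zero_of_lt hv hδ q hlt]
  · have hx := simple_of_le_topEig_of_gap hη0 hδ hgap x (not_lt.1 hlt)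
    rw [cutDensityPow_eq_of_simple hv hdiv δ q hx]
    have hlam0 : 0 < torusStrainTopEig v x := topEig_pos_of_simple hv hdiv hx
    have hA0 := topDiagSq_nonneg v x
    have hR0 := topChannelW_nonneg hx
    have hg0 : 0 ≤ cutPowDeriv δ q (torusStrainTopEig v x) := cutPowDeriv_nonneg_of_one_le hq hδ hlam0
    have hG0 : 0 ≤ cutPow δ q (torusStrainTopEig v x) := cutPow_nonneg q hlam0.le
    positivity

/-- **THE POINTWISE COMPARISON BELOW `q = 2` ON THE TOP-GAP CLASS.** For `v` smooth and divergence free on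
`T³`, `1 ≤ q ≤ 2`, `0 < η ≤ 1`, `δ > 0`, `λ₂ ≤ (1−η)λ₁` everywhere, at EVERY point `x`:
`∑ₖ∑ᵢⱼ (∂ₖ M^δ_qᵢⱼ(x))² ≤ (1/(2η)) · λ₁(x)^{q−2} · cutDensityPow δ q v x`. [ours] -/
theorem sum_sq_partialDeriv_cutProjPow_le_cutDensityPow_of_le_two (hv : Torus.IsSmooth v)
    (hdiv : Torus.IsDivFree v) {δ q η : ℝ} (hq1 : 1 ≤ q) (hq2 : q ≤ 2) (hδ : 0 < δ) (hη0 : 0 < η)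
    (hη1 : η ≤ 1)
    (hgap : ∀ x : UnitAddTorus (Fin 3), torusStrainMidEig v x ≤ (1 - η) * torusStrainTopEig v x)
    (x : UnitAddTorus (Fin 3)) :
    ∑ k, ∑ i, ∑ j, (Torus.partialDeriv k (cutProjPow δ q v i j) x) ^ 2 ≤
      1 / (2 * η) * torusStrainTopEig v x ^ (q - 2) * cutDensityPow δ q v x := by
  by_cases hlt : torusStrainTopEig v x < δ
  · simp_rw [partialDeriv_cutProjPow_eq_zero_of_lt hv hδ q hlt]
    rw [cutDensityPow_eq_zero_of_lt hv hδ q hlt]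
    simp
  · have hx := simple_of_le_topEig_of_gap hη0 hδ hgap x (not_lt.1 hlt)
    have h1 := sum_sq_partialDeriv_cutProjPow_le_of_gap_of_le_two (δ := δ) hv hdiv hq1 hq2 hδ hη0 hx (hgap x)
    rw [cutDensityPow_eq_of_simple hv hdiv δ q hx]
    have hlam0 : 0 < torusStrainTopEig v x := topEig_pos_of_simple hv hdiv hx
    have hL0 : 0 ≤ torusStrainTopEig v x ^ (q - 2) := Real.rpow_nonneg hlam0.le _
    have hA0 := topDiagSq_nonneg v x
    have hR0 := topChannelW_nonneg hx
    have hg0 : 0 ≤ cutPowDeriv δ q (torusStrainTopEig v x) := cutPowDeriv_nonneg_of_one_le hq1 hδ hlam0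
    have hG0 : 0 ≤ cutPow δ q (torusStrainTopEig v x) := cutPow_nonneg q hlam0.le
    set L := torusStrainTopEig v x ^ (q - 2)
    set gA := cutPowDeriv δ q (torusStrainTopEig v x) * topDiagSq v x
    set GR := cutPow δ q (torusStrainTopEig v x) * topChannelW v x
    have hgA : 0 ≤ gA := mul_nonneg hg0 hA0
    have hGR : 0 ≤ GR := mul_nonneg hG0 hR0
    have e1 : torusStrainTopEig v x ^ (q - 2) *
        (cutPowDeriv δ q (torusStrainTopEig v x) * topDiagSq v x +
          2 / η * cutPow δ q (torusStrainTopEig v x) * topChannelW v x) = L * (gA + 2 / η * GR) := by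
      simp only [L, gA, GR]; ring
    have e2 : 1 / (2 * η) * torusStrainTopEig v x ^ (q - 2) *
        (2 * cutPowDeriv δ q (torusStrainTopEig v x) * topDiagSq v x +
          4 * cutPow δ q (torusStrainTopEig v x) * topChannelW v x) =
        L * (1 / η * gA + 2 / η * GR) := by
      simp only [L, gA, GR]; field_simp; ring
    rw [e1] at h1
    rw [e2]
    have hc1 : gA ≤ 1 / η * gA := by
      have : (1 : ℝ) ≤ 1 / η := by rw [le_div_iff₀ hη0]; linarith
      have := mul_le_mul_of_nonneg_right this hgA
      rwa [one_mul] at this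
    calc ∑ k, ∑ i, ∑ j, (Torus.partialDeriv k (cutProjPow δ q v i j) x) ^ 2
        ≤ L * (gA + 2 / η * GR) := h1
      _ ≤ L * (1 / η * gA + 2 / η * GR) := mul_le_mul_of_nonneg_left (by linarith) hL0

/-- **TWO LEVELS, THE DENSITY: `ρ^δ_q(x) ≤ (2/(q−1)) · ρ^ε_q(x)` at EVERY point**, for `v` smooth and
divergence free of the top-gap class (`0 < η`), `1 < q ≤ 2`, `0 < ε` and `4ε ≤ δ`. Where `λ₁ < δ` the left
side vanishes and the right side is `≥ 0`; where `λ₁ ≥ δ ≥ 4ε` both are `2H'A + 4HR` at their level and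
`(q−1)H_δ' ≤ H_ε'`, `H_δ ≤ 2H_ε`. [ours] -/
theorem cutDensityPow_le_of_le_two (hv : Torus.IsSmooth v) (hdiv : Torus.IsDivFree v)
    {δ ε q η : ℝ} (hq1 : 1 < q) (hq2 : q ≤ 2) (hε : 0 < ε) (hεδ : 4 * ε ≤ δ) (hη0 : 0 < η)
    (hgap : ∀ x : UnitAddTorus (Fin 3), torusStrainMidEig v x ≤ (1 - η) * torusStrainTopEig v x)
    (x : UnitAddTorus (Fin 3)) :
    cutDensityPow δ q v x ≤ 2 / (q - 1) * cutDensityPow ε q v x := by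
  have hδ : 0 < δ := by linarith
  have hq1' : 0 < q - 1 := by linarith
  have hρε : 0 ≤ cutDensityPow ε q v x := cutDensityPow_nonneg_of_one_le hv hdiv hq1.le hε hη0 hgap x
  by_cases hlt : torusStrainTopEig v x < δ
  · rw [cutDensityPow_eq_zero_of_lt hv hδ q hlt]
    positivity
  · have hxδ : δ ≤ torusStrainTopEig v x := not_lt.1 hlt
    have hx := simple_of_le_topEig_of_gap hη0 hδ hgap x hxδ
    rw [cutDensityPow_eq_of_simple hv hdiv δ q hx, cutDensityPow_eq_of_simple hv hdiv ε q hx]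
    set lam := torusStrainTopEig v x with hlam
    have hlam0 : 0 < lam := topEig_pos_of_simple hv hdiv hx
    have hA0 := topDiagSq_nonneg v x
    have hR0 := topChannelW_nonneg hx
    have h4 : 4 * ε ≤ lam := hεδ.trans hxδ
    have h2 : 2 * ε ≤ lam := by linarith
    have hH : cutPow δ q lam ≤ 2 * cutPow ε q lam := cutPow_le_two_mul_cutPow hε h4
    have hH' : (q - 1) * cutPowDeriv δ q lam ≤ cutPowDeriv ε q lam :=
      mul_cutPowDeriv_le_cutPowDeriv hq1.le hq2 hε h2
    have hgε0 : 0 ≤ cutPowDeriv ε q lam := cutPowDeriv_nonneg_of_one_le hq1.le hε hlam0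
    have hGε0 : 0 ≤ cutPow ε q lam := cutPow_nonneg q hlam0.le
    -- `2H_δ'A ≤ (2/(q−1)) H_ε' A` and `4H_δR ≤ 8H_εR ≤ (2/(q−1))·4H_εR`
    have hc : (2 : ℝ) ≤ 2 / (q - 1) := by
      rw [le_div_iff₀ hq1']; nlinarith
    have ha : 2 * cutPowDeriv δ q lam * topDiagSq v x ≤ 2 / (q - 1) * (2 * cutPowDeriv ε q lam * topDiagSq v x) := by
      have h1 := mul_le_mul_of_nonneg_right hH' hA0
      have e : 2 * cutPowDeriv δ q lam * topDiagSq v x =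
          2 / (q - 1) * ((q - 1) * cutPowDeriv δ q lam * topDiagSq v x) := by
        field_simp
      rw [e]
      have h3 : 0 ≤ cutPowDeriv ε q lam * topDiagSq v x := mul_nonneg hgε0 hA0
      exact mul_le_mul_of_nonneg_left (h1.trans (by linarith)) (by positivity)
    have hb : 4 * cutPow δ q lam * topChannelW v x ≤ 2 / (q - 1) * (4 * cutPow ε q lam * topChannelW v x) := by
      have h1 := mul_le_mul_of_nonneg_right hH hR0
      have h3 : 0 ≤ 4 * cutPow ε q lam * topChannelW v x := by positivity
      nlinarith
    calc 2 * cutPowDeriv δ q lam * topDiagSq v x + 4 * cutPow δ q lam * topChannelW v x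
        ≤ 2 / (q - 1) * (2 * cutPowDeriv ε q lam * topDiagSq v x) +
          2 / (q - 1) * (4 * cutPow ε q lam * topChannelW v x) := add_le_add ha hb
      _ = 2 / (q - 1) * (2 * cutPowDeriv ε q lam * topDiagSq v x + 4 * cutPow ε q lam * topChannelW v x) := by
          ring

end TopEig

end Summit.NavierStokesRegularity.FunctionalMining

end
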